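import Literature.Probability.Moments.VarianceBookkeeping
import Summits.AtomisticToContinuum.HydrodynamicLimit.Theses.JParityClosure
import Summits.AtomisticToContinuum.HydrodynamicLimit.Theorems.JParityClosureEvenStressEnskogEnskogRateDeviationRung0
import Summits.AtomisticToContinuum.HydrodynamicLimit.Theorems.JParityClosureOddContactSymmetryGibbsInvariance
import HarnessLib

/-!
# The Enskog rate functional has vanishing Gibbs variance at rung 0 (`stub_enskogRateVarianceRung0`,
# helper stub (hE)₀ of the crux line `even-rung-mean-variance`, `JParityClosure.EvenStressEnskog`,
# stmt-AtomisticToContinuum-13079)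

Under the rung-0 local Gibbs law `G_N` (constant profiles `a, u, θ`) of `N + 1` hard spheres of
diameter `σ(N+1)^{-1/3}` on `𝕋³`, the Enskog rate functional
`e_t(z) = ∫ χ(t,x) ψ(σ³ρ_r(z,x)) B_r Ξ_L (z,x) dx` (`ψ = g · Y`) read along any hard-sphere flow is
measurable and has Gibbs variance `≤ ς` for `N ≥ N₀`, uniformly in `t ≤ τ` and in the components `k, l`.

Proof.  (1) `G_N` is `Φ_t`-invariant (`measurePreserving_flow_localGibbsLaw_const`), so the variance of
`e_t ∘ Φ_t` is the STATIC variance of `e_t` (`MeasurePreserving.variance_fun_comp`).  (2) The variance of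
the `x`-average `e_t` is at most `∫_x E_G[(χ(t,x)ψ(σ³ρ_r)B_r − χ(t,x)ψ(σ³)Θ̄)²] dx ≤ ‖χ‖²_∞ ∫_x J_N(x) dx`
(`variance_integral_le_integral_integral_sq`), with the `t`-INDEPENDENT mean-square deviation
`J_N(x) = E_G[(ψ(σ³ρ_r(·,x)) B_r(·,x) − ψ(σ³)Θ̄)²]` of the companion file (`integral_sq_deviation_le`:
velocity `U`-statistic variance + vanishing variance of the mollified density).  (3) `J_N(x) → 0` at
every `x` (`tendsto_integral_sq_deviation`), boundedly, hence `∫_x J_N → 0` (dominated convergence over the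
compact torus); finitely many `k, l`.  The cutoff scale `η₀` and the smallness `σ₀` are those of H4
(`exists_bound_mul_contactValue`, the equation of state `HsEosLowDensity_holds`, `exists_smallDensity`).
-/

noncomputable section

open MeasureTheory ProbabilityTheory Set Filter Topology
open scoped ENNReal InnerProductSpace BigOperators

namespace Summit.AtomisticToContinuum.HydrodynamicLimit.Theorems.EvenStressEnskog

open Literature.Analysis.FluidPDE Literature.MathematicalPhysics.KineticTheory
open Literature.MathematicalPhysics.StatisticalMechanics Literature.Probability.Moments
open Summit.AtomisticToContinuum.HydrodynamicLimit.Theses.JParityClosure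

/-! ## The mean-square deviation tends to zero, pointwise and integrated -/

/-- **The mean-square deviation at one point tends to zero** as `N → ∞`, for the uniform gas at small
reduced density, `ψ` bounded on `[0, ∞)`, measurable and continuous at `σ³`, `0 ≤ L`, `0 < r < 1/2`:
choose `ε`, then `δ` (continuity), then `N` (`integral_sq_deviation_le`, the position variance
`tendsto_integral_sq_empDensity_sub_one` and `(N+1)⁻¹ → 0`). [folklore] -/
theorem tendsto_integral_sq_deviation {σ a θ : ℝ} {u : V3} (hsd : SmallDensity uniformProfile σ)
    (ha : 0 < a) (hθ : 0 < θ) {ψ : ℝ → ℝ} (hψm : Measurable ψ) {K : ℝ} (hK : ∀ y, 0 ≤ y → |ψ y| ≤ K)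
    (hψc : ContinuousAt ψ (σ ^ 3)) (k l : Fin 3) {L r : ℝ} (hL : 0 ≤ L) (hr : 0 < r) (hr2 : r < 1 / 2)
    (x₀ : T3) (Φ : (N : ℕ) → HardSphereFlow (Torus.geometry (Fin 3)) (hsDiameter σ N) (N + 1)) :
    Tendsto (fun N : ℕ => ∫ z, (ψ (σ ^ 3 * mollDensity r z x₀) * pairFunctional r (evenMarkTrunc k l L) z x₀ -
        ψ (σ ^ 3) * ∫ p, sphereMark (evenMarkTrunc k l L) p.1 p.2
          ∂((gaussMeasure u θ).prod (gaussMeasure u θ))) ^ 2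
        ∂(localGibbsLaw σ (fun _ => a) (fun _ => u) (fun _ => θ) N (Φ N))) atTop (𝓝 0) := by
  have hσ : 0 < σ := hsd.σ_pos
  have hσ2 : σ ≤ 1 / 2 := hsd.σ_lt_half.le
  set M : ℝ := 3 / (Real.pi * r ^ 3) with hM
  set CΘ : ℝ := 2 * L * (2 * L) * (sphereMeasure : Measure (Metric.sphere (0 : V3) 1)).real univ with hCΘ
  set Θb : ℝ := ∫ p, sphereMark (evenMarkTrunc k l L) p.1 p.2 ∂((gaussMeasure u θ).prod (gaussMeasure u θ))
    with hΘb
  have hK0 : 0 ≤ K := (abs_nonneg _).trans (hK 0 le_rfl)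
  have hM0 : 0 ≤ M := by rw [hM]; positivity
  set D : ℝ := K * (M * M) + K with hD
  set A : ℝ := K * (M + 1) + 1 with hA
  set β : ℝ := 2 * Θb ^ 2 * D with hβ
  have hD0 : 0 ≤ D := by rw [hD]; positivity
  have hA0 : 0 < A := by rw [hA]; positivity
  have hβ0 : 0 ≤ β := by rw [hβ]; positivity
  set V : ℕ → ℝ := fun N => ∫ xs, (empDensity r xs x₀ - 1) ^ 2
    ∂posGibbsMeasure (fun _ : T3 => a) (hsDiameter σ N) (N + 1) with hV
  have hVlim : Tendsto V atTop (𝓝 0) := tendsto_integral_sq_empDensity_sub_one hsd ha hr hr2 x₀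
  have h1 : Tendsto (fun N : ℕ => (((N + 1 : ℕ) : ℝ))⁻¹) atTop (𝓝 0) :=
    tendsto_inv_atTop_zero.comp ((tendsto_natCast_atTop_atTop (R := ℝ)).comp (tendsto_add_atTop_nat 1))
  rw [Metric.tendsto_atTop]
  intro η hη
  set ε : ℝ := η / (2 * (β * A + 1)) with hε
  have hε0 : 0 < ε := by rw [hε]; positivity
  obtain ⟨δ, hδ, hδε⟩ := Metric.continuousAt_iff.1 hψc ε hε0
  set C' : ℝ := K * (M + 1) / (4 * ε) + 2 * K * (σ ^ 3) ^ 2 / δ ^ 2 with hC'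
  have hR : Tendsto (fun N : ℕ => 2 * K ^ 2 * (8 * M ^ 4 * CΘ ^ 2 * (((N + 1 : ℕ) : ℝ))⁻¹) +
      β * (C' * V N + K * M ^ 2 * (((N + 1 : ℕ) : ℝ))⁻¹)) atTop (𝓝 0) := by
    have h := ((h1.const_mul (8 * M ^ 4 * CΘ ^ 2)).const_mul (2 * K ^ 2)).add
      (((hVlim.const_mul C').add (h1.const_mul (K * M ^ 2))).const_mul β)
    simpa only [mul_zero, add_zero] using h
  obtain ⟨N₀, hN₀⟩ := Metric.tendsto_atTop.1 hR (η / 2) (by positivity)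
  refine ⟨N₀, fun N hN => ?_⟩
  have hJ := integral_sq_deviation_le (u := u) hσ hσ2 ha hθ hψm hK hε0 hδ (fun y hy => hδε hy) k l hL hr x₀ N (Φ N)
  have hRN := hN₀ N hN
  rw [Real.dist_eq, sub_zero] at hRN
  have hAε : β * (A * ε) ≤ η / 2 := by
    have e : β * (A * ε) = η / 2 * (β * A / (β * A + 1)) := by
      rw [hε]; field_simp
    rw [e]
    have h2 : β * A / (β * A + 1) ≤ 1 := (div_le_one (by positivity)).2 (by linarith)
    calc η / 2 * (β * A / (β * A + 1)) ≤ η / 2 * 1 := mul_le_mul_of_nonneg_left h2 (by positivity)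
      _ = η / 2 := mul_one _
  rw [Real.dist_eq, sub_zero, abs_of_nonneg (integral_nonneg fun z => sq_nonneg _)]
  calc _ ≤ _ := hJ
    _ = β * (A * ε) + (2 * K ^ 2 * (8 * M ^ 4 * CΘ ^ 2 * (((N + 1 : ℕ) : ℝ))⁻¹) +
          β * (C' * V N + K * M ^ 2 * (((N + 1 : ℕ) : ℝ))⁻¹)) := by ring
    _ < η / 2 + η / 2 := add_lt_add_of_le_of_lt hAε ((le_abs_self _).trans_lt hRN)
    _ = η := by ring

/-- Joint measurability of `(z, x₀) ↦ (ψ(σ³ρ_r(z,x₀)) B_r Ξ_L (z,x₀) − c)²` for measurable `ψ`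
(continuity of `ρ_r`, `B_r` in `(z, x₀)`). [folklore] -/
theorem measurable_sq_deviation (σ : ℝ) (N : ℕ) {ψ : ℝ → ℝ} (hψm : Measurable ψ) (k l : Fin 3)
    (L r c : ℝ) :
    Measurable fun q : Config (N + 1) (Fin 3) T3 × T3 =>
      (ψ (σ ^ 3 * mollDensity r q.1 q.2) * pairFunctional r (evenMarkTrunc k l L) q.1 q.2 - c) ^ 2 := by
  haveI : OpensMeasurableSpace (Config (N + 1) (Fin 3) T3 × T3) := Prod.opensMeasurableSpace
  have hρ : Continuous fun q : Config (N + 1) (Fin 3) T3 × T3 => σ ^ 3 * mollDensity r q.1 q.2 :=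
    continuous_const.mul (continuous_mollDensity_comp r continuous_fst continuous_snd)
  exact (((hψm.comp hρ.measurable).mul (continuous_pairFunctional_comp r (continuous_evenMarkTrunc k l L)
    continuous_fst continuous_snd).measurable).sub measurable_const).pow_const 2

/-- **The mean-square deviation is a bounded measurable function of the point `x₀`**: measurable as a
parametric integral (`StronglyMeasurable.integral_prod_left'`), and bounded by
`(K · M²·4L²|S²| + K · 4L²|S²|)²` under the (probability) local Gibbs law, `σ ≤ 1/2`. [folklore] -/
theorem measurable_integral_sq_deviation_and_le {σ a θ : ℝ} {u : V3} (hσ : 0 < σ) (hσ2 : σ ≤ 1 / 2)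
    (ha : 0 < a) (hθ : 0 < θ) {ψ : ℝ → ℝ} (hψm : Measurable ψ) {K : ℝ} (hK : ∀ y, 0 ≤ y → |ψ y| ≤ K)
    (k l : Fin 3) {L r : ℝ} (hL : 0 ≤ L) (hr : 0 < r) (N : ℕ)
    (Φ : HardSphereFlow (Torus.geometry (Fin 3)) (hsDiameter σ N) (N + 1)) :
    Measurable (fun x₀ : T3 => ∫ z, (ψ (σ ^ 3 * mollDensity r z x₀) * pairFunctional r (evenMarkTrunc k l L) z x₀ -
        ψ (σ ^ 3) * ∫ p, sphereMark (evenMarkTrunc k l L) p.1 p.2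
          ∂((gaussMeasure u θ).prod (gaussMeasure u θ))) ^ 2
        ∂(localGibbsLaw σ (fun _ => a) (fun _ => u) (fun _ => θ) N Φ)) ∧
    ∀ x₀ : T3, ∫ z, (ψ (σ ^ 3 * mollDensity r z x₀) * pairFunctional r (evenMarkTrunc k l L) z x₀ -
        ψ (σ ^ 3) * ∫ p, sphereMark (evenMarkTrunc k l L) p.1 p.2
          ∂((gaussMeasure u θ).prod (gaussMeasure u θ))) ^ 2
        ∂(localGibbsLaw σ (fun _ => a) (fun _ => u) (fun _ => θ) N Φ) ≤
      (K * ((3 / (Real.pi * r ^ 3)) * (3 / (Real.pi * r ^ 3)) *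
        (2 * L * (2 * L) * (sphereMeasure : Measure (Metric.sphere (0 : V3) 1)).real univ)) +
        K * (2 * L * (2 * L) * (sphereMeasure : Measure (Metric.sphere (0 : V3) 1)).real univ)) ^ 2 := by
  set Ξ := evenMarkTrunc k l L with hΞ
  set M : ℝ := 3 / (Real.pi * r ^ 3) with hM
  set CΘ : ℝ := 2 * L * (2 * L) * (sphereMeasure : Measure (Metric.sphere (0 : V3) 1)).real univ with hCΘ
  set G := localGibbsLaw σ (fun _ => a) (fun _ => u) (fun _ => θ) N Φ with hG
  set Θb : ℝ := ∫ p, sphereMark Ξ p.1 p.2 ∂((gaussMeasure u θ).prod (gaussMeasure u θ)) with hΘb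
  haveI : IsProbabilityMeasure G := isProbabilityMeasure_localGibbsLaw continuous_const
    continuous_const continuous_const (fun _ => ha) (fun _ => hθ) hσ2 N Φ
  have hK0 : 0 ≤ K := (abs_nonneg _).trans (hK 0 le_rfl)
  have hM0 : 0 ≤ M := by rw [hM]; positivity
  have hΘb : |Θb| ≤ CΘ := abs_integral_sphereMark_le u θ k l hL
  have hpFabs : ∀ (z : Config (N + 1) (Fin 3) T3) (x₀ : T3), |pairFunctional r Ξ z x₀| ≤ M * M * CΘ :=
    fun z x₀ => abs_pairFunctional_evenMarkTrunc_le k l hL hr z x₀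
  have hb : ∀ (z : Config (N + 1) (Fin 3) T3) (x₀ : T3),
      |(ψ (σ ^ 3 * mollDensity r z x₀) * pairFunctional r Ξ z x₀ - ψ (σ ^ 3) * Θb) ^ 2| ≤
        (K * (M * M * CΘ) + K * CΘ) ^ 2 := by
    intro z x₀
    rw [abs_pow]
    refine pow_le_pow_left₀ (abs_nonneg _) ((abs_sub _ _).trans (add_le_add ?_ ?_)) 2
    · rw [abs_mul]
      exact mul_le_mul (hK _ (mul_nonneg (pow_nonneg hσ.le 3) (mollDensity_nonneg hr z x₀))) (hpFabs z x₀)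
        (abs_nonneg _) hK0
    · rw [abs_mul]; exact mul_le_mul (hK _ (pow_nonneg hσ.le 3)) hΘb (abs_nonneg _) hK0
  refine ⟨?_, fun x₀ => ?_⟩
  · haveI := isFiniteMeasure_localGibbsLaw σ (fun _ : T3 => a) (fun _ => u) (fun _ => θ) N Φ
    exact ((measurable_sq_deviation σ N hψm k l L r (ψ (σ ^ 3) * Θb)).stronglyMeasurable.integral_prod_left'
      (μ := G)).measurable
  · have h := norm_integral_le_of_norm_le_const (μ := G)
      (f := fun z => (ψ (σ ^ 3 * mollDensity r z x₀) * pairFunctional r Ξ z x₀ - ψ (σ ^ 3) * Θb) ^ 2)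
      (C := (K * (M * M * CΘ) + K * CΘ) ^ 2) (ae_of_all _ fun z => by rw [Real.norm_eq_abs]; exact hb z x₀)
    rw [probReal_univ, mul_one, Real.norm_eq_abs] at h
    exact (le_abs_self _).trans h

/-- **The integrated mean-square deviation tends to zero**: `∫_{𝕋³} J_N(x₀) dx₀ → 0` (dominated
convergence over the compact torus: `tendsto_integral_sq_deviation` pointwise, the uniform bound of
`measurable_integral_sq_deviation_and_le`). [folklore] -/
theorem tendsto_integral_integral_sq_deviation {σ a θ : ℝ} {u : V3} (hsd : SmallDensity uniformProfile σ)
    (ha : 0 < a) (hθ : 0 < θ) {ψ : ℝ → ℝ} (hψm : Measurable ψ) {K : ℝ} (hK : ∀ y, 0 ≤ y → |ψ y| ≤ K)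
    (hψc : ContinuousAt ψ (σ ^ 3)) (k l : Fin 3) {L r : ℝ} (hL : 0 ≤ L) (hr : 0 < r) (hr2 : r < 1 / 2)
    (Φ : (N : ℕ) → HardSphereFlow (Torus.geometry (Fin 3)) (hsDiameter σ N) (N + 1)) :
    Tendsto (fun N : ℕ => ∫ x₀ : T3, ∫ z, (ψ (σ ^ 3 * mollDensity r z x₀) * pairFunctional r (evenMarkTrunc k l L) z x₀ -
        ψ (σ ^ 3) * ∫ p, sphereMark (evenMarkTrunc k l L) p.1 p.2
          ∂((gaussMeasure u θ).prod (gaussMeasure u θ))) ^ 2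
        ∂(localGibbsLaw σ (fun _ => a) (fun _ => u) (fun _ => θ) N (Φ N))) atTop (𝓝 0) := by
  have hσ : 0 < σ := hsd.σ_pos
  have hσ2 : σ ≤ 1 / 2 := hsd.σ_lt_half.le
  set C : ℝ := (K * ((3 / (Real.pi * r ^ 3)) * (3 / (Real.pi * r ^ 3)) *
    (2 * L * (2 * L) * (sphereMeasure : Measure (Metric.sphere (0 : V3) 1)).real univ)) +
    K * (2 * L * (2 * L) * (sphereMeasure : Measure (Metric.sphere (0 : V3) 1)).real univ)) ^ 2 with hC
  have hml := fun N : ℕ =>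
    measurable_integral_sq_deviation_and_le (u := u) hσ hσ2 ha hθ hψm hK k l hL hr N (Φ N)
  have hD := tendsto_integral_of_dominated_convergence (μ := (volume : Measure T3)) (fun _ => C)
    (fun N => (hml N).1.aestronglyMeasurable) (integrable_const C)
    (fun N => ae_of_all _ fun x₀ => by
      rw [Real.norm_eq_abs, abs_of_nonneg (integral_nonneg fun z => sq_nonneg _)]
      exact (hml N).2 x₀)
    (ae_of_all _ fun x₀ => tendsto_integral_sq_deviation hsd ha hθ hψm hK hψc k l hL hr hr2 x₀ Φ)
  simpa only [integral_zero] using hD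

/-! ## The registered stub -/

/-- **(hE)₀ · the Enskog rate functional is measurable and has vanishing Gibbs variance at rung 0**
(registered helper stub `stub_enskogRateVarianceRung0` of the line `even-rung-mean-variance`, verbatim;
the `(hE)` antecedent of `stub_fixedTimeVarianceOfEvolved` at constant profiles).  `η₀ := min (η'/2) η₁`
(`η'` the analyticity radius of the equation of state, `η₁` the cutoff scale of
`exists_bound_mul_contactValue`), `σ₀ := min σ₁ (η₀/2)` (`σ₁` from `exists_smallDensity uniformProfile`),
`r₀ := 1/4`; `N₀` from `tendsto_integral_integral_sq_deviation` for the nine `k, l` at once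
(`Filter.eventually_all`); then flow invariance, `variance_integral_le_integral_integral_sq` with the
centring `χ(t,x) ψ(σ³) Θ̄`, and `χ² ≤ ‖χ‖²_∞` on `[0, τ] × 𝕋³`.  `κ` is not used. [folklore] -/
theorem stub_enskogRateVarianceRung0 :
    ∃ η₀ : ℝ, 0 < η₀ ∧ ∀ (a θ : ℝ) (u : V3), 0 < a → 0 < θ → ∃ σ₀ : ℝ, 0 < σ₀ ∧ ∀ σ : ℝ, 0 < σ → σ < σ₀ →
      ∀ Φ : (N : ℕ) → HardSphereFlow (Torus.geometry (Fin 3)) (hsDiameter σ N) (N + 1), ∀ τ : ℝ, 0 < τ →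
      ∀ χ : ℝ × UnitAddTorus (Fin 3) → ℝ, Continuous χ → ∀ g : ℝ → ℝ, Continuous g → (∀ a, η₀ ≤ a →
      g a = 0) → ∀ ς : ℝ, 0 < ς → ∃ r₀ : ℝ, 0 < r₀ ∧ ∀ r : ℝ, 0 < r → r < r₀ → ∀ L κ : ℝ, 1 ≤ L → 0 < κ →
      κ ≤ 1 → ∃ N₀ : ℕ, ∀ N : ℕ, N₀ ≤ N → ∀ k l : Fin 3, ∀ t ∈ Set.Icc (0 : ℝ) τ,
      (Measurable fun z => enskogRate σ N χ g (evenMarkTrunc k l L) r t z) ∧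
      ProbabilityTheory.variance (fun z => enskogRate σ N χ g (evenMarkTrunc k l L) r t ((Φ N).flow t z))
      (localGibbsLaw σ (fun _ => a) (fun _ => u) (fun _ => θ) N (Φ N)) ≤ ς := by
  -- buildfix 2026-08-19: `JParityClosure.HsEosLowDensity_holds` is no longer linked in the route file; the item's
  -- tree proof `Theorems.hsEosLowDensity_proof` (same statement, via `Theses.ImplosionDichotomy`) is used directly.
  obtain ⟨η₁, hη₁, hbound⟩ := exists_bound_mul_contactValue _root_.Summit.AtomisticToContinuum.HydrodynamicLimit.Theorems.hsEosLowDensity_proof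
  obtain ⟨η', hη', F, hF, hEq, -, -, -⟩ := _root_.Summit.AtomisticToContinuum.HydrodynamicLimit.Theorems.hsEosLowDensity_proof
  refine ⟨min (η' / 2) η₁, lt_min (by positivity) hη₁, ?_⟩
  intro a θ u ha hθ
  obtain ⟨σ₁, hσ₁, hsmall⟩ := exists_smallDensity uniformProfile one_pos
  have hη₀ : 0 < min (η' / 2) η₁ := lt_min (by positivity) hη₁
  refine ⟨min σ₁ (min (η' / 2) η₁ / 2), lt_min hσ₁ (by positivity), ?_⟩
  intro σ hσ hσσ₀ Φ τ hτ χ hχ g hg hg0 ς hς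
  have hsd : SmallDensity uniformProfile σ := (hsmall σ hσ (hσσ₀.trans_le (min_le_left _ _))).1
  have hσ2 : σ ≤ 1 / 2 := hsd.σ_lt_half.le
  have hσ3 : σ ^ 3 < min (η' / 2) η₁ := by
    have h1 : σ ^ 3 ≤ σ ^ 1 := pow_le_pow_of_le_one hσ.le (by linarith) (by norm_num)
    have h2 : σ < min (η' / 2) η₁ / 2 := hσσ₀.trans_le (min_le_right _ _)
    rw [pow_one] at h1
    linarith
  refine ⟨1 / 4, by norm_num, ?_⟩
  intro r hr hr4 L κ hL _hκ _hκ1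
  have hr2 : r < 1 / 2 := by linarith
  have hL0 : 0 ≤ L := by linarith
  -- `ψ = g · Y`: measurable, bounded on `[0, ∞)`, continuous at `σ³ ∈ (0, η')`
  obtain ⟨K, hK0, hK⟩ := hbound g hg fun b hb => hg0 b ((min_le_right _ _).trans hb)
  have hs : 0 < σ ^ 3 := pow_pos hσ 3
  have hs' : σ ^ 3 < η' := by have := (lt_min_iff.1 hσ3).1; linarith
  set ψ : ℝ → ℝ := fun b => g b * contactValue b with hψ
  have hψm : Measurable ψ := hg.measurable.mul measurable_contactValue
  have hψc : ContinuousAt ψ (σ ^ 3) := by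
    have hnhds : hsExcessFreeEnergy =ᶠ[𝓝 (σ ^ 3)] F :=
      Filter.eventuallyEq_of_mem (isOpen_Ioo.mem_nhds ⟨hs, hs'⟩) (hEq.mono Ioo_subset_Ico_self)
    have hY : (fun b => 3 / (2 * Real.pi) * deriv F b) =ᶠ[𝓝 (σ ^ 3)] contactValue :=
      hnhds.deriv.mono fun b hb => by rw [contactValue, hb]
    have hFc : ContinuousAt (deriv F) (σ ^ 3) :=
      hF.deriv.continuousOn.continuousAt (isOpen_Ioo.mem_nhds ⟨by linarith, hs'⟩)
    exact hg.continuousAt.mul ((hFc.const_mul _).congr hY)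
  -- `χ` is bounded on `[0, τ] × 𝕋³`
  have hKc : IsCompact (Set.Icc (0 : ℝ) τ ×ˢ (univ : Set (UnitAddTorus (Fin 3)))) :=
    isCompact_Icc.prod isCompact_univ
  obtain ⟨Cχ, hCχ⟩ := hKc.exists_bound_of_continuousOn hχ.continuousOn
  have hCχ0 : 0 ≤ Cχ := (norm_nonneg _).trans (hCχ (0, 0) ⟨⟨le_rfl, hτ.le⟩, mem_univ _⟩)
  -- the static limit, for the nine marks at once
  set ς' : ℝ := ς / (Cχ ^ 2 + 1) with hς'
  have hς'0 : 0 < ς' := by rw [hς']; positivity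
  have hev : ∀ᶠ N : ℕ in atTop, ∀ k l : Fin 3,
      ∫ x₀ : T3, ∫ z, (ψ (σ ^ 3 * mollDensity r z x₀) * pairFunctional r (evenMarkTrunc k l L) z x₀ -
        ψ (σ ^ 3) * ∫ p, sphereMark (evenMarkTrunc k l L) p.1 p.2
          ∂((gaussMeasure u θ).prod (gaussMeasure u θ))) ^ 2
        ∂(localGibbsLaw σ (fun _ => a) (fun _ => u) (fun _ => θ) N (Φ N)) < ς' :=
    eventually_all.2 fun k => eventually_all.2 fun l =>
      (tendsto_integral_integral_sq_deviation hsd ha hθ hψm hK hψc k l hL0 hr hr2 Φ).eventually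
        (gt_mem_nhds hς'0)
  obtain ⟨N₀, hN₀⟩ := eventually_atTop.1 hev
  refine ⟨N₀, fun N hN k l t ht => ?_⟩
  have hJN := hN₀ N hN k l
  set Ξ := evenMarkTrunc k l L with hΞ
  set M : ℝ := 3 / (Real.pi * r ^ 3) with hM
  set CΘ : ℝ := 2 * L * (2 * L) * (sphereMeasure : Measure (Metric.sphere (0 : V3) 1)).real univ with hCΘ
  set G := localGibbsLaw σ (fun _ => a) (fun _ => u) (fun _ => θ) N (Φ N) with hG
  set Θb : ℝ := ∫ p, sphereMark Ξ p.1 p.2 ∂((gaussMeasure u θ).prod (gaussMeasure u θ)) with hΘb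
  set J : T3 → ℝ := fun x₀ => ∫ z, (ψ (σ ^ 3 * mollDensity r z x₀) * pairFunctional r Ξ z x₀ -
    ψ (σ ^ 3) * Θb) ^ 2 ∂G with hJdef
  haveI : IsProbabilityMeasure G := isProbabilityMeasure_localGibbsLaw continuous_const
    continuous_const continuous_const (fun _ => ha) (fun _ => hθ) hσ2 N (Φ N)
  have hΞc : Continuous Ξ := continuous_evenMarkTrunc k l L
  have hmeas : Measurable fun z => enskogRate σ N χ g Ξ r t z :=
    (measurable_enskogRate_uncurry σ N hχ hg hΞc r).comp (measurable_const.prodMk measurable_id)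
  refine ⟨hmeas, ?_⟩
  have hJml := measurable_integral_sq_deviation_and_le (u := u) hσ hσ2 ha hθ hψm hK k l hL0 hr N (Φ N)
  have hJ0 : ∀ x₀, 0 ≤ J x₀ := fun x₀ => integral_nonneg fun z => sq_nonneg _
  have hM0 : 0 ≤ M := by rw [hM]; positivity
  have hΘb : |Θb| ≤ CΘ := abs_integral_sphereMark_le u θ k l hL0
  -- the integrand of `e_t` and its centring
  have hFm : Measurable (Function.uncurry fun (z : Config (N + 1) (Fin 3) T3) (x : T3) =>
      χ (t, x) * g (σ ^ 3 * mollDensity r z x) * contactValue (σ ^ 3 * mollDensity r z x) *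
        pairFunctional r Ξ z x) :=
    (measurable_enskogIntegrand σ N hχ hg hΞc r).comp ((measurable_const.prodMk measurable_fst).prodMk
      measurable_snd)
  have hχb : ∀ x : T3, |χ (t, x)| ≤ Cχ := fun x => by
    simpa only [Real.norm_eq_abs] using hCχ (t, x) ⟨ht, mem_univ _⟩
  have hFb : ∀ (z : Config (N + 1) (Fin 3) T3) (x : T3), |χ (t, x) * g (σ ^ 3 * mollDensity r z x) *
      contactValue (σ ^ 3 * mollDensity r z x) * pairFunctional r Ξ z x| ≤ Cχ * (K * (M * M * CΘ)) := by
    intro z x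
    have e : χ (t, x) * g (σ ^ 3 * mollDensity r z x) * contactValue (σ ^ 3 * mollDensity r z x) *
        pairFunctional r Ξ z x = χ (t, x) * ((g (σ ^ 3 * mollDensity r z x) *
          contactValue (σ ^ 3 * mollDensity r z x)) * pairFunctional r Ξ z x) := by ring
    rw [e, abs_mul, abs_mul]
    exact mul_le_mul (hχb x) (mul_le_mul (hK _ (mul_nonneg hs.le (mollDensity_nonneg hr z x)))
      (abs_pairFunctional_evenMarkTrunc_le k l hL0 hr z x) (abs_nonneg _) hK0)
      (mul_nonneg (abs_nonneg _) (abs_nonneg _)) hCχ0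
  have hmm : Measurable fun x : T3 => χ (t, x) * (ψ (σ ^ 3) * Θb) :=
    (hχ.comp (continuous_const.prodMk continuous_id)).measurable.mul_const _
  have hmb : ∀ x : T3, |χ (t, x) * (ψ (σ ^ 3) * Θb)| ≤ Cχ * (K * CΘ) := fun x => by
    rw [abs_mul, abs_mul]
    exact mul_le_mul (hχb x) (mul_le_mul (hK _ hs.le) hΘb (abs_nonneg _) hK0)
      (mul_nonneg (abs_nonneg _) (abs_nonneg _)) hCχ0
  have hvar := variance_integral_le_integral_integral_sq (μ := G) (ν := (volume : Measure T3)) hFm hFb hmm hmb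
  have hinner : ∀ x : T3, ∫ z, (χ (t, x) * g (σ ^ 3 * mollDensity r z x) *
      contactValue (σ ^ 3 * mollDensity r z x) * pairFunctional r Ξ z x - χ (t, x) * (ψ (σ ^ 3) * Θb)) ^ 2 ∂G =
      χ (t, x) ^ 2 * J x := fun x => by
    calc _ = ∫ z, χ (t, x) ^ 2 * (ψ (σ ^ 3 * mollDensity r z x) * pairFunctional r Ξ z x -
          ψ (σ ^ 3) * Θb) ^ 2 ∂G := integral_congr_ae (ae_of_all _ fun z => by simp only [hψ]; ring)
      _ = χ (t, x) ^ 2 * J x := integral_const_mul _ _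
  have hJi : Integrable (fun x => Cχ ^ 2 * J x) (volume : Measure T3) :=
    (Integrable.of_bound hJml.1.aestronglyMeasurable _ (ae_of_all _ fun x₀ => by
      rw [Real.norm_eq_abs, abs_of_nonneg (hJ0 x₀)]; exact hJml.2 x₀)).const_mul _
  have hχ2 : ∀ x : T3, χ (t, x) ^ 2 ≤ Cχ ^ 2 := fun x => by
    rw [← sq_abs]; exact pow_le_pow_left₀ (abs_nonneg _) (hχb x) 2
  calc variance (fun z => enskogRate σ N χ g Ξ r t ((Φ N).flow t z)) G
      = variance (fun z => enskogRate σ N χ g Ξ r t z) G :=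
        MeasurePreserving.variance_fun_comp (measurePreserving_flow_localGibbsLaw_const σ a θ u N (Φ N) t)
          hmeas.aemeasurable
    _ ≤ ∫ x, ∫ z, (χ (t, x) * g (σ ^ 3 * mollDensity r z x) * contactValue (σ ^ 3 * mollDensity r z x) *
          pairFunctional r Ξ z x - χ (t, x) * (ψ (σ ^ 3) * Θb)) ^ 2 ∂G := hvar
    _ = ∫ x, χ (t, x) ^ 2 * J x := integral_congr_ae (ae_of_all _ hinner)
    _ ≤ ∫ x, Cχ ^ 2 * J x :=
        integral_mono_of_nonneg (ae_of_all _ fun x => mul_nonneg (sq_nonneg _) (hJ0 x)) hJi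
          (ae_of_all _ fun x => mul_le_mul_of_nonneg_right (hχ2 x) (hJ0 x))
    _ = Cχ ^ 2 * ∫ x, J x := integral_const_mul _ _
    _ ≤ Cχ ^ 2 * ς' := mul_le_mul_of_nonneg_left hJN.le (sq_nonneg _)
    _ ≤ ς := by
        rw [hς', show Cχ ^ 2 * (ς / (Cχ ^ 2 + 1)) = ς * (Cχ ^ 2 / (Cχ ^ 2 + 1)) by ring]
        have h1 : Cχ ^ 2 / (Cχ ^ 2 + 1) ≤ 1 := (div_le_one (by positivity)).2 (by linarith)
        calc ς * (Cχ ^ 2 / (Cχ ^ 2 + 1)) ≤ ς * 1 := mul_le_mul_of_nonneg_left h1 hς.le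
          _ = ς := mul_one ς

end Summit.AtomisticToContinuum.HydrodynamicLimit.Theorems.EvenStressEnskog

end
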